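import Summits.QuantumFields.YangMills.Theorems.BalabanUVNodesK0RecordFormatNamesDecay
import Summits.QuantumFields.YangMills.Theorems.BalabanUVNodesK0RecordFormatNamesLemmas4
import Summits.QuantumFields.YangMills.Theorems.BalabanUVNodesK2NamedJetsRunRemAt

/-!
# K1ᴬ — THE GENERIC β-CONTINUITY KERNEL: (1.22)'s second moment of the LIMIT kernel is continuous in the coupling history on the box,
# GIVEN locally uniform volume convergence (the (1.21) letter, uniform form), (5.10)-decay of the limit kernel, and continuity of the finite-volume kernels

Cell `ym-nodeO-ideate`, porter lineage `ymgap-nodeO-port-PTB-1` (gen 6, prover; PT-B lane COMPLETE per director-ym №554 — this file is the by-name OFFER-1 of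
nodeO STATUS 2026-08-31T10:42:22Z).  It executes the «KERNEL (generic, M, provable OUTRIGHT, no Bałaban content)» of ◆ CRIT-1 g37's β-KERNEL DEDUP MAP
(nodeO STATUS l.5142, 2026-08-31T10:38:42Z; ■ REF g108 PASS 8 bytes-grounded) over the EXISTING generic §1 names of ✓`…K0RecordFormatNamesDecay`
(`pvolOf`, `plimOf`, `PlimDecayOnBoxOf`, `FlowStep.Box`, `FlowStep.BetaContH`) and ✓`…K2NamedJetsRunRemAt.SurvCont` — with NO new definition: the two letters
DEF-1 is to type ((T-β1) «locally uniform (1.21) on the box», (T-β3) «finite-volume kernels continuous in the history») enter here as HYPOTHESIS BINDERS spelled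
by their bodies, so that once the named letters land the record corollary is `fun h1 h2 h3 => betaContH_secondMoment_plimOf … h1 h2 h3` after unfolding.
`--kind proof --supports stmt-QuantumFields-27239 --as helper`; count-neutral; NOT a stub, NOT a skeleton act, NOT a K1ᴬ hand (№555 stands).

WHAT IS PROVED (pure Mathlib analysis; [I] = [Balaban1987RG1] supplies only the context: (1.21)–(1.22) p.264, (5.10) p.293, §1 pp.263–264 «It is a C^∞-function of
g_{j−1} ∈ [0,γ]»):
* `continuousOn_plimOf_entry` — per lattice point `z`, the `(0,1)`-entry of the LIMIT kernel `v ↦ plimOf F fam ρ bV k v 0 1 z` is continuous on `Box γ k`, from locally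
  uniform convergence of the finite-volume entries (h1) and their continuity (h3) (`TendstoLocallyUniformlyOn.continuousOn`).
* `betaContH_secondMoment_plimOf` — ★ the kernel: under (h1), (5.10)-decay of the limit kernel on the box with ONE `(C, δ₁)` (h2 = ✓`PlimDecayOnBoxOf`) and (h3),
  `BetaContH γ (fun k v => B12Beta.secondMoment (plimOf F fam ρ bV k v) 0 1)` (`continuousOn_tsum` with the summable dominator `C·|z|₁²e^{−δ₁|z|₁}` of
  ✓`B12Sec2to5.majorant_summable` ∕ ✓`abs_term_le_of_decay510`).
* `betaContH_of_eq_secondMoment_plimOf` — the same for ANY history-dependent `β : HBeta` that EQUALS that second moment on the box (the record's β does, on its box: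
  ✓`K0RecordFormatNamesLemmas4.betaOfRecord₈Tχ_of_mem_box`), at any level `γ₀ ≤ γ` (✓`FlowStep.box_mono`).
* `survCont_of_eq_secondMoment_plimOf` — ⟹ run-wise survivor continuity `SurvCont β γ₀` (✓`SurvCont.of_betaContH`), the (C) conjunct `stub_cont13` adds.
* `betaContH_secondMoment_plimOf_of_uniformlyOn` — the variant with print's UNIFORM-on-the-box convergence (⟹ locally uniform).
* §4 RECORD FACES (χ-generic Stage 8, then the re-centred Stage-13 β of record `Node00.betaOfRecord₁₃Ax`, an `abbrev` over Stage 8): the same three inputs AT THE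
  INSTANCE `(mergedTermFamilyMatT F N T χ θ₈.εbg, θ₈.ρ8, θ₈.bV)` on a box of side `γ ≤ θ₈.γ` give `BetaContH γ₀ (betaOfRecord₈Tχ F N T χ θ₈)` and
  `SurvCont (betaOfRecord₁₃Ax F N θ) γ₀` for `0 < γ₀ ≤ γ` (✓`betaOfRecord₈Tχ_of_mem_box`).  When DEF-1's (ℓ1) letters (T-β1)∕(T-β2)∕(T-β3) land as NAMES for these
  three bodies, `stub_cont13`'s (C) conjunct at a rows witness is `survCont_betaOfRecord₁₃Ax_of_kernelLetters` after unfolding them (the rows are carried verbatim,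
  cf. the skeleton's `stubCont13_of_cont13All`).

HONEST FRAMING.  Generic analysis lemmas over DEFINED selection-free names; every Bałaban estimate ((1.21) uniform existence, (5.10), finite-volume continuity) is a
HYPOTHESIS here, discharged by nobody; nothing of Bałaban is asserted, ported or discharged; K1ᴬ ⟨stmt-QuantumFields-27239⟩ OPEN, its stubs 0∕6; K0ᴬ∕K1ᴬ∕K3ᴬ 0∕3;
NODE O 0∕1; COUNT 8∕28 · K 1∕4 UNMOVED; finite `𝕋⁴_{L^K}` at fixed ε — NOT continuum ∕ ℝ⁴ ∕ OS; **the Yang–Mills mass gap (Clay) is NOT proved by any of this.**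
No `sorry`, `instance`, `notation`; standard axioms.
-/

noncomputable section

open scoped BigOperators Matrix.Norms.L2Operator Topology
open Set Filter

namespace Summit.QuantumFields.YangMills.Theorems.K1AxBetaContKernel

open Literature.MathematicalPhysics.QuantumFieldTheory.Balaban1983to89
open Literature.MathematicalPhysics.QuantumFieldTheory.Balaban1983to89.Node00
open Literature.MathematicalPhysics.QuantumFieldTheory.Balaban1983to89.T4Continuum (T4Family)
open Literature.MathematicalPhysics.QuantumFieldTheory.Balaban1983to89.FlowStep
open Summit.QuantumFields.YangMills.Theorems.K0RecordFormatNames (pvolOf plimOf PlimDecayOnBoxOf)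
open Summit.QuantumFields.YangMills.Theorems.BalabanUVNodesK2NamedJetsRunRemAt (SurvCont)

variable (F : T4Family)
variable {𝔄 : Type*} [NormedRing 𝔄] [NormedAlgebra ℝ 𝔄]
variable {V : Type*} [NormedAddCommGroup V] [NormedSpace ℝ V] {ι : Type*} [Fintype ι]
variable (fam : TermFamily1 F 𝔄) (ρ : V →L[ℝ] 𝔄) (bV : Module.Basis ι ℝ V)

/-! ## §1  Per-entry continuity of the limit kernel on the box -/

/-- **Per lattice point, the limit kernel's `(0,1)`-entry is continuous in the history on the box**: if the finite-volume entries
`v ↦ pvolOf F fam ρ bV k v K 0 1 z` converge LOCALLY UNIFORMLY on `Box γ k` to `v ↦ plimOf F fam ρ bV k v 0 1 z` as `K → ∞` and each is continuous on the box,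
so is the limit (`TendstoLocallyUniformlyOn.continuousOn`).  Context: [I] (1.21) p.264 «This limit exists by the localized representation (1.7)». [folklore] -/
theorem continuousOn_plimOf_entry {γ : ℝ} {k : ℕ} {z : Fin 4 → ℤ}
    (h1 : TendstoLocallyUniformlyOn (fun K v => pvolOf F fam ρ bV k v K 0 1 z) (fun v => plimOf F fam ρ bV k v 0 1 z) atTop (Box γ k))
    (h3 : ∀ K : ℕ, ContinuousOn (fun v => pvolOf F fam ρ bV k v K 0 1 z) (Box γ k)) :
    ContinuousOn (fun v => plimOf F fam ρ bV k v 0 1 z) (Box γ k) :=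
  h1.continuousOn (Frequently.of_forall h3)

/-- The summand of (1.22) at one lattice point is continuous on the box when the entry is. [folklore] -/
theorem continuousOn_term {γ : ℝ} {k : ℕ} {z : Fin 4 → ℤ}
    (h : ContinuousOn (fun v => plimOf F fam ρ bV k v 0 1 z) (Box γ k)) :
    ContinuousOn (fun v => plimOf F fam ρ bV k v 0 1 z * (z 0 : ℝ) * (z 1 : ℝ)) (Box γ k) :=
  (h.mul continuousOn_const).mul continuousOn_const

/-! ## §2  The kernel: continuity of the second moment on the box -/

/-- ★ **THE GENERIC β-CONTINUITY KERNEL.**  For a term family `fam`, chart `ρ`, colour basis `bV` and a box side `γ`: IF (h1) for every step `k` and lattice point `z` the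
finite-volume entries `v ↦ pvolOf … k v K 0 1 z` converge locally uniformly on `Box γ k` to the limit entry as `K → ∞` ((1.21), uniform form), (h2) the limit kernel obeys
(5.10) on the box with ONE `(C, δ₁)`, `δ₁ > 0` (`PlimDecayOnBoxOf`), and (h3) every finite-volume entry is continuous in the history on the box — THEN the second moment
(1.22) `v ↦ Σ_z Π(v; z) z₀ z₁` of the limit kernel is continuous on every box: `BetaContH γ (fun k v => secondMoment (plimOf … k v) 0 1)`.  Proof: per `z` by §1, then
`continuousOn_tsum` with the summable dominator `C·|z|₁² e^{−δ₁|z|₁}` (`B12Sec2to5.majorant_summable`, `abs_term_le_of_decay510`).  No Bałaban content: the three inputs are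
hypotheses. Context: [I] §1 pp.263–264, (1.21)–(1.22) p.264, (5.10) p.293. [folklore] -/
theorem betaContH_secondMoment_plimOf {γ C δ₁ : ℝ}
    (h1 : ∀ (k : ℕ) (z : Fin 4 → ℤ), TendstoLocallyUniformlyOn (fun K v => pvolOf F fam ρ bV k v K 0 1 z)
      (fun v => plimOf F fam ρ bV k v 0 1 z) atTop (Box γ k))
    (h2 : PlimDecayOnBoxOf F fam ρ bV γ C δ₁)
    (h3 : ∀ (k K : ℕ) (z : Fin 4 → ℤ), ContinuousOn (fun v => pvolOf F fam ρ bV k v K 0 1 z) (Box γ k)) :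
    BetaContH γ (fun k v => B12Beta.secondMoment (plimOf F fam ρ bV k v) 0 1) := by
  intro k
  have hS : Summable (fun z : Fin 4 → ℤ => C * (B12Sec2to5.l1 z ^ 2 * Real.exp (-δ₁ * B12Sec2to5.l1 z))) :=
    (B12Sec2to5.majorant_summable h2.1 4).mul_left C
  refine continuousOn_tsum (fun z => continuousOn_term F fam ρ bV (continuousOn_plimOf_entry F fam ρ bV (h1 k z) (fun K => h3 k K z))) hS ?_
  intro z v hv
  rw [Real.norm_eq_abs]
  exact B12Sec2to5.abs_term_le_of_decay510 (h2.2 k v hv) 0 1 z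

/-- **The kernel with print's UNIFORM convergence on the box** (⟹ locally uniform, `TendstoUniformlyOn.tendstoLocallyUniformlyOn`). [folklore] -/
theorem betaContH_secondMoment_plimOf_of_uniformlyOn {γ C δ₁ : ℝ}
    (h1 : ∀ (k : ℕ) (z : Fin 4 → ℤ), TendstoUniformlyOn (fun K v => pvolOf F fam ρ bV k v K 0 1 z)
      (fun v => plimOf F fam ρ bV k v 0 1 z) atTop (Box γ k))
    (h2 : PlimDecayOnBoxOf F fam ρ bV γ C δ₁)
    (h3 : ∀ (k K : ℕ) (z : Fin 4 → ℤ), ContinuousOn (fun v => pvolOf F fam ρ bV k v K 0 1 z) (Box γ k)) :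
    BetaContH γ (fun k v => B12Beta.secondMoment (plimOf F fam ρ bV k v) 0 1) :=
  betaContH_secondMoment_plimOf F fam ρ bV (fun k z => (h1 k z).tendstoLocallyUniformlyOn) h2 h3

/-! ## §3  For a β that IS the second moment on the box; the run-wise (C) letter -/

/-- **Any history-dependent `β` that EQUALS the second moment of the limit kernel on the box `]0, γ]^{k+1}` is continuous on every box of side `γ₀ ≤ γ`**
(the three kernel inputs as in `betaContH_secondMoment_plimOf`; `ContinuousOn.congr` + `FlowStep.box_mono`).  The record's β has this shape on its box
(`K0RecordFormatNamesLemmas4.betaOfRecord₈Tχ_of_mem_box`). [folklore] -/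
theorem betaContH_of_eq_secondMoment_plimOf {β : HBeta} {γ γ₀ C δ₁ : ℝ} (hle : γ₀ ≤ γ)
    (hβ : ∀ (k : ℕ) (v : Fin (k + 1) → ℝ), v ∈ Box γ k → β k v = B12Beta.secondMoment (plimOf F fam ρ bV k v) 0 1)
    (h1 : ∀ (k : ℕ) (z : Fin 4 → ℤ), TendstoLocallyUniformlyOn (fun K v => pvolOf F fam ρ bV k v K 0 1 z)
      (fun v => plimOf F fam ρ bV k v 0 1 z) atTop (Box γ k))
    (h2 : PlimDecayOnBoxOf F fam ρ bV γ C δ₁)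
    (h3 : ∀ (k K : ℕ) (z : Fin 4 → ℤ), ContinuousOn (fun v => pvolOf F fam ρ bV k v K 0 1 z) (Box γ k)) :
    BetaContH γ₀ β := fun k =>
  (((betaContH_secondMoment_plimOf F fam ρ bV h1 h2 h3) k).congr (fun v hv => hβ k v hv)).mono (box_mono hle k)

/-- **⟹ RUN-WISE SURVIVOR CONTINUITY** `SurvCont β γ₀` at every level `0 < γ₀ ≤ γ` (`SurvCont.of_betaContH`) — the (C) conjunct that `stub_cont13` of K1ᴬ's skeleton
adds to the run rows, for a β of the second-moment shape, GIVEN the three kernel inputs. [folklore] -/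
theorem survCont_of_eq_secondMoment_plimOf {β : HBeta} {γ γ₀ C δ₁ : ℝ} (hγ₀ : 0 < γ₀) (hle : γ₀ ≤ γ)
    (hβ : ∀ (k : ℕ) (v : Fin (k + 1) → ℝ), v ∈ Box γ k → β k v = B12Beta.secondMoment (plimOf F fam ρ bV k v) 0 1)
    (h1 : ∀ (k : ℕ) (z : Fin 4 → ℤ), TendstoLocallyUniformlyOn (fun K v => pvolOf F fam ρ bV k v K 0 1 z)
      (fun v => plimOf F fam ρ bV k v 0 1 z) atTop (Box γ k))
    (h2 : PlimDecayOnBoxOf F fam ρ bV γ C δ₁)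
    (h3 : ∀ (k K : ℕ) (z : Fin 4 → ℤ), ContinuousOn (fun v => pvolOf F fam ρ bV k v K 0 1 z) (Box γ k)) :
    SurvCont β γ₀ :=
  SurvCont.of_betaContH hγ₀ (betaContH_of_eq_secondMoment_plimOf F fam ρ bV hle hβ h1 h2 h3)

/-! ## §4  Record faces: def-B's χ-generic Stage-8 β and the re-centred Stage-13 β of record -/

section Stage8

variable {F}
variable {N : ℕ} [NeZero N]

/-- **STAGE-8 FACE (χ-generic)**: the three kernel inputs for the merged family `mergedTermFamilyMatT F N T χ θ₈.εbg` in the chart `(θ₈.ρ8, θ₈.bV)` on a box of side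
`γ ≤ θ₈.γ` give continuity of def-B's β `betaOfRecord₈Tχ F N T χ θ₈` on every box of side `γ₀ ≤ γ` — because ON ITS BOX that β IS the second moment of `plimOf` of the
merged family (`betaOfRecord₈Tχ_of_mem_box`).  Inputs are hypotheses; nothing of [I] asserted. Context: [I] §1 pp.263–264, (1.21)–(1.22) p.264, (5.10) p.293. [folklore] -/
theorem betaContH_betaOfRecord₈Tχ_of_kernelLetters (T : Transport F N) (χ : (K : ℕ) → (ℕ → ℝ) → (k : ℕ) → Density (F.P K) k (SU N))
    (θ₈ : Stage8Params F N) {γ γ₀ C δ₁ : ℝ} (hle : γ₀ ≤ γ) (hγ : γ ≤ θ₈.γ)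
    (h1 : letI := θ₈.instVβ₁; letI := θ₈.instVβ₂; letI := θ₈.instιβ
      ∀ (k : ℕ) (z : Fin 4 → ℤ), TendstoLocallyUniformlyOn
        (fun K v => pvolOf F (mergedTermFamilyMatT F N T χ θ₈.εbg) θ₈.ρ8 θ₈.bV k v K 0 1 z)
        (fun v => plimOf F (mergedTermFamilyMatT F N T χ θ₈.εbg) θ₈.ρ8 θ₈.bV k v 0 1 z) atTop (Box γ k))
    (h2 : letI := θ₈.instVβ₁; letI := θ₈.instVβ₂; letI := θ₈.instιβ
      PlimDecayOnBoxOf F (mergedTermFamilyMatT F N T χ θ₈.εbg) θ₈.ρ8 θ₈.bV γ C δ₁)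
    (h3 : letI := θ₈.instVβ₁; letI := θ₈.instVβ₂; letI := θ₈.instιβ
      ∀ (k K : ℕ) (z : Fin 4 → ℤ), ContinuousOn
        (fun v => pvolOf F (mergedTermFamilyMatT F N T χ θ₈.εbg) θ₈.ρ8 θ₈.bV k v K 0 1 z) (Box γ k)) :
    BetaContH γ₀ (betaOfRecord₈Tχ F N T χ θ₈) := by
  letI := θ₈.instVβ₁; letI := θ₈.instVβ₂; letI := θ₈.instιβ
  refine betaContH_of_eq_secondMoment_plimOf F (mergedTermFamilyMatT F N T χ θ₈.εbg) θ₈.ρ8 θ₈.bV hle ?_ h1 h2 h3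
  intro k v hv
  exact K0RecordFormatNames.betaOfRecord₈Tχ_of_mem_box F T χ θ₈ (box_mono hγ k hv)

/-- **STAGE-13 FACE AT THE RE-CENTRED RECORD**: for `θ : Stage13Params F N`, the three kernel inputs for the record's merged family
`mergedTermFamilyMatT F N (TβOfRecord₁₃ F N) (chiβOfRecord₁₃Ax F N θ) θ₈.εbg`, `θ₈ := θ.toStage8Params`, on a box of side `γ ≤ θ₈.γ` give RUN-WISE SURVIVOR CONTINUITY
`SurvCont (betaOfRecord₁₃Ax F N θ) γ₀` at every level `0 < γ₀ ≤ γ` (`betaOfRecord₁₃Ax` is def-B's β at that `(T, χ, θ₈)` by `rfl`; `SurvCont.of_betaContH`).  This is the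
(C) conjunct `stub_cont13` adds, GIVEN the three inputs — which are [I] (1.21) (uniform form), (5.10) for the limit kernel, and finite-volume continuity, discharged by nobody here.
[folklore] -/
theorem survCont_betaOfRecord₁₃Ax_of_kernelLetters (θ : Stage13Params F N) {γ γ₀ C δ₁ : ℝ} (hγ₀ : 0 < γ₀) (hle : γ₀ ≤ γ)
    (hγ : γ ≤ θ.toStage8Params.γ)
    (h1 : letI θ₈ := θ.toStage8Params; letI := θ₈.instVβ₁; letI := θ₈.instVβ₂; letI := θ₈.instιβ
      ∀ (k : ℕ) (z : Fin 4 → ℤ), TendstoLocallyUniformlyOn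
        (fun K v => pvolOf F (mergedTermFamilyMatT F N (TβOfRecord₁₃ F N) (chiβOfRecord₁₃Ax F N θ) θ₈.εbg) θ₈.ρ8 θ₈.bV k v K 0 1 z)
        (fun v => plimOf F (mergedTermFamilyMatT F N (TβOfRecord₁₃ F N) (chiβOfRecord₁₃Ax F N θ) θ₈.εbg) θ₈.ρ8 θ₈.bV k v 0 1 z) atTop (Box γ k))
    (h2 : letI θ₈ := θ.toStage8Params; letI := θ₈.instVβ₁; letI := θ₈.instVβ₂; letI := θ₈.instιβ
      PlimDecayOnBoxOf F (mergedTermFamilyMatT F N (TβOfRecord₁₃ F N) (chiβOfRecord₁₃Ax F N θ) θ₈.εbg) θ₈.ρ8 θ₈.bV γ C δ₁)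
    (h3 : letI θ₈ := θ.toStage8Params; letI := θ₈.instVβ₁; letI := θ₈.instVβ₂; letI := θ₈.instιβ
      ∀ (k K : ℕ) (z : Fin 4 → ℤ), ContinuousOn
        (fun v => pvolOf F (mergedTermFamilyMatT F N (TβOfRecord₁₃ F N) (chiβOfRecord₁₃Ax F N θ) θ₈.εbg) θ₈.ρ8 θ₈.bV k v K 0 1 z) (Box γ k)) :
    SurvCont (betaOfRecord₁₃Ax F N θ) γ₀ :=
  SurvCont.of_betaContH hγ₀
    (betaContH_betaOfRecord₈Tχ_of_kernelLetters (TβOfRecord₁₃ F N) (chiβOfRecord₁₃Ax F N θ) θ.toStage8Params hle hγ h1 h2 h3)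

end Stage8

end Summit.QuantumFields.YangMills.Theorems.K1AxBetaContKernel

end
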